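import Summits.ResolutionOfSingularities.ResolutionOfSingularities.Theorems.JetCutJetKernels
import HarnessLib

/-!
# JetCutJetKernels2 — decomp-res node «JetCut» (lens-2 g15 rev 5), file 2/4 of `JetCutJetKernels`

Content VERBATIM from the decomp-res lens-2 file `HOME/decomp-res-lens-2/g15/JetCut.lean` rev 5 (pin 9f53e5ca =
`parts/JetCut-rev5-9f53e5ca.lean`, 7 495 l;
HOME = run/shared/lean/pub/decomp-res; CRITIC-LEDGER rows 109 / 115 / 120 / 121 / 122 / 127 / 133 CLEARED; landing
order INBOX :231; the critic's
HYGIENE-landing.md h1–h11 applied — DOCSTRING-ONLY).  The lens's blocks RESTATED VERBATIM from lens-2 g12 / g13 /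
g14 (§R / §R13 / §R14) are DELETED:
they are the tree's `RelativeDeltaCut*` / `CurveLeafExit*` / `PinchCut*` modules (namespaces `RelativeDeltaCut`,
`CurveLeafExit`, `PinchCut`, opened;
the lens's `CurveLeafExitRestated.x` / `PinchCutRestated.x` are cited as `CurveLeafExit.x` / `PinchCut.x`, the three
pointwise engine edges of g12 as
`RelativeDeltaCut.x`).  Namespace `…Theorems.JetCut` (the lens's `Theses.JetCut` is gate-reserved), sub-namespaces
`Tame` / `Wide` / `Broad` / `Vast`
as in the lens; file split only (tree files ≤ 400 lines): sections, variables and every declaration exactly as in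
the lens, the long rev-0/1 prose
lives in HOME/decomp-res-lens-2/g15/NODE-g15.md §ARCHIVE-A (not in the tree).  Node files, in import order:
`JetCutJetKernels`, `JetCutPoint`, `JetCutClasses`, `JetCutKernels`, `JetCutTame`, `JetCutTameClasses`,
`JetCutTameKernels`, `JetCutLadder`, `JetCutWideClasses`, `JetCutWideKernels`, `JetCutMixed`, `JetCutBroadClasses`,
`JetCutBroadKernels`, `JetCutDegenerate`, `JetCutVastClasses`, `JetCutVastKernels`
(each possibly continued `…2`, `…3`), then the wiring `MaxContactCutJetCut*` (in the Theses cone).  All `--supports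
stmt-ResolutionOfSingularities-29273`
(`MaxContactCut.RungOne`); nothing closes 29273 — decided cells carry their engines as hypotheses, and exactly ONE
located-residual aside is booked on
the route for this column (`Vast.VastSpecialRung`, home `JetCutVastClasses`).

§J1 + §J1b: RING LEVEL of the jet test — the chart relations `chartRel` of the blow-up algebra of a regular
sequence, the ONE-STEP test `JetShallow`, and its KERNELS over an arbitrary commutative ring: representability of
`(c)^{m+1}` by forms, **`jetShallow_of_coneShallow`** ((C) ⊆ (J), PROVED), `not_jetShallow_zero` (quantifier-shape
sanity), the typed (CT) test `ConeTailShallow`, the regularity port `ExcParamRegular`,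
**`jetShallow_of_coneTailShallow`** ((CT) ⊆ (J) modulo the port, PROVED).

Part 2/4 carries: `jetShallow_of_coneShallow`, `not_jetShallow_zero`, `ConeTailShallow`.

(Sources: HunekeSwanson2006 Cor. 5.5.5; CossartJannsenSaito2020 Ch. 2, Thm. 3.6/3.7, Ch. 8; CossartPiltant2008 Prop.
4.2; CossartPiltant2019 Rem. 3.2; Hironaka1964 Ch. III; Hironaka1967; Hironaka1977; Moh1987; Giraud1975.)
-/

open CategoryTheory AlgebraicGeometry TopologicalSpace IsLocalRing
open Literature.AlgebraicGeometry.Resolution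
open Summit.ResolutionOfSingularities.ResolutionOfSingularities.Theorems
open Summit.ResolutionOfSingularities.ResolutionOfSingularities.Theorems.WeakOrderReduction
open Summit.ResolutionOfSingularities.ResolutionOfSingularities.Theorems.DeltaFaceCutClasses
open Summit.ResolutionOfSingularities.ResolutionOfSingularities.Theorems.RelativeDeltaCut
open Summit.ResolutionOfSingularities.ResolutionOfSingularities.Theorems.CurveLeafExit
open Summit.ResolutionOfSingularities.ResolutionOfSingularities.Theorems.PinchCut

namespace Summit.ResolutionOfSingularities.ResolutionOfSingularities.Theorems.JetCut

section JetKernels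

variable {R : Type} [CommRing R] {d : ℕ}

/-- **(C) ⊆ (J) at ring level**: a slope-one prepared cone presentation that is cone-shallow is jet-shallow. [folklore] -/
theorem jetShallow_of_coneShallow {n : ℕ} (hn : n ≠ 0) (c : Fin (d + 1) → R) (v g : R)
    (Φ : MvPolynomial (Fin d) R) (J : Ideal R)
    (hΦdeg : ∀ m ∈ Φ.support, Finsupp.degree m = n)
    (hΦcoef : ∀ m ∈ Φ.support, Φ.coeff m ∈ Ideal.span (Set.range c ∪ {v}))
    (hg : g ∈ Ideal.span (Set.range c) ^ (n + 1))
    (hf : c 0 ^ n + MvPolynomial.eval (fun i : Fin d => c i.succ) Φ + g ∈ J)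
    (hC : ConeShallow (Ideal.span (Set.range c)) v Φ n) :
    JetShallow (Ideal.span (Set.range c ∪ {v})) c J n := by
  classical
  set P : Ideal R := Ideal.span (Set.range c) with hP
  set M : Ideal R := Ideal.span (Set.range c ∪ {v}) with hM
  have hPM : P ≤ M := Ideal.span_mono Set.subset_union_left
  have hcP : ∀ i, c i ∈ P := fun i => Ideal.subset_span ⟨i, rfl⟩
  have hcM : ∀ i, c i ∈ M := fun i => hPM (hcP i)
  have hvM : v ∈ M := Ideal.subset_span (Or.inr rfl)
  obtain ⟨G, hGh, hGc, hGe⟩ := exists_form_of_mem_span_pow_succ c n hg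
  have hΦh : Φ.IsHomogeneous n := by
    intro m hm
    have hm' : m ∈ Φ.support := MvPolynomial.mem_support_iff.2 hm
    have h := hΦdeg m hm'
    rw [Finsupp.degree_eq_weight_one] at h
    exact h
  have hΦcoef' : ∀ β, Φ.coeff β ∈ M := by
    intro β
    by_cases hβ : β ∈ Φ.support
    · exact hΦcoef β hβ
    · rw [MvPolynomial.notMem_support_iff.1 hβ]; exact Ideal.zero_mem _
  set Φt : MvPolynomial (Fin (d + 1)) R := MvPolynomial.rename Fin.succ Φ with hΦt
  set F : MvPolynomial (Fin (d + 1)) R := MvPolynomial.X 0 ^ n + Φt + G with hF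
  intro j Q hQ hMQ hXj
  have hCQ : ∀ r ∈ M, (MvPolynomial.C r : MvPolynomial (Fin (d + 1)) R) ∈ Q :=
    fun r hr => hMQ (Ideal.mem_map_of_mem _ hr)
  have hrel : chartRel c j ≤ Q := by
    rw [chartRel, Ideal.span_le]
    rintro _ ⟨i, rfl⟩
    exact Q.sub_mem (hCQ _ (hcM i)) (Q.mul_mem_right _ (hCQ _ (hcM j)))
  have hsub : chartRel c j ⊔ Q ^ n ≤ Q := sup_le hrel (Ideal.pow_le_self hn)
  -- the pieces of `dehomog j F`
  have hsplit : dehomog j F = dehomog j (MvPolynomial.X 0 ^ n) + dehomog j Φt + dehomog j G := by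
    simp only [hF, dehomog, map_add]
  have halg : ∀ b ∈ M, algebraMap R (MvPolynomial (Fin (d + 1)) R) b ∈ Q := by
    intro b hb
    rw [MvPolynomial.algebraMap_eq]
    exact hCQ b hb
  have hΦtQ : dehomog j Φt ∈ Q := by
    have h := algHom_apply_mem_of_coeff_mem
      ((MvPolynomial.aeval fun i : Fin (d + 1) =>
          if i = j then (1 : MvPolynomial (Fin (d + 1)) R) else MvPolynomial.X i).comp
        (MvPolynomial.rename Fin.succ)) M Q halg Φ hΦcoef'
    simpa [dehomog, hΦt] using h
  have hGQ : dehomog j G ∈ Q :=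
    algHom_apply_mem_of_coeff_mem _ P Q (fun b hb => halg b (hPM hb)) G hGc
  refine ⟨F, ?_, ?_, ?_⟩
  · -- homogeneous of degree `n`
    refine ((MvPolynomial.isHomogeneous_X_pow (0 : Fin (d + 1)) n).add ?_).add hGh
    exact hΦh.rename_isHomogeneous
  · -- value at `c`
    have : MvPolynomial.eval c F = c 0 ^ n + MvPolynomial.eval (fun i : Fin d => c i.succ) Φ + g := by
      simp [hF, hΦt, MvPolynomial.eval_rename, hGe, Function.comp_def]
    rw [this]
    exact hf
  · -- non-membership
    intro hmem
    have hFQ : dehomog j F ∈ Q := hsub hmem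
    by_cases hj0 : j = 0
    · subst hj0
      have h1 : dehomog (0 : Fin (d + 1)) (MvPolynomial.X 0 ^ n : MvPolynomial (Fin (d + 1)) R) = 1 := by
        simp [dehomog]
      have : (1 : MvPolynomial (Fin (d + 1)) R) ∈ Q := by
        have h := Q.sub_mem (Q.sub_mem hFQ hGQ) hΦtQ
        rwa [hsplit, h1, add_sub_cancel_right, add_sub_cancel_right] at h
      exact hQ.ne_top ((Ideal.eq_top_iff_one _).2 this)
    · obtain ⟨i, rfl⟩ := Fin.exists_succ_eq.2 hj0
      have hdX : dehomog (Fin.succ i) (MvPolynomial.X 0 ^ n : MvPolynomial (Fin (d + 1)) R) =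
          MvPolynomial.X 0 ^ n := by
        simp [dehomog, (Fin.succ_ne_zero i).symm]
      by_cases hX0 : (MvPolynomial.X 0 : MvPolynomial (Fin (d + 1)) R) ∈ Q
      · -- residue transport to `(R ⧸ P)[U]`
        haveI : Q.IsMaximal := hQ
        letI : Field (MvPolynomial (Fin (d + 1)) R ⧸ Q) := Ideal.Quotient.field Q
        set mkQ := Ideal.Quotient.mk Q with hmkQ
        -- ψ : kill `X 0`, shift variables, reduce coefficients mod `P`
        set ψ : MvPolynomial (Fin (d + 1)) R →ₐ[R] MvPolynomial (Fin d) (R ⧸ P) :=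
          MvPolynomial.aeval (Fin.cases (0 : MvPolynomial (Fin d) (R ⧸ P)) fun k => MvPolynomial.X k) with hψ
        have hψC : ∀ a : R, ψ (MvPolynomial.C a) = MvPolynomial.C (Ideal.Quotient.mk P a) := by
          intro a
          simp [hψ, MvPolynomial.algebraMap_apply]
        have hψX0 : ψ (MvPolynomial.X 0) = 0 := by simp [hψ]
        have hψXs : ∀ k : Fin d, ψ (MvPolynomial.X k.succ) = MvPolynomial.X k := by
          intro k; simp [hψ]
        -- χ : (R ⧸ P)[U] → R[X]/Q with χ ∘ ψ = mkQ
        have hker : ∀ a ∈ P, (mkQ.comp MvPolynomial.C) a = 0 := by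
          intro a ha
          simp only [RingHom.comp_apply, hmkQ, Ideal.Quotient.eq_zero_iff_mem]
          exact hCQ a (hPM ha)
        set χ : MvPolynomial (Fin d) (R ⧸ P) →+* MvPolynomial (Fin (d + 1)) R ⧸ Q :=
          MvPolynomial.eval₂Hom (Ideal.Quotient.lift P (mkQ.comp MvPolynomial.C) hker)
            (fun k => mkQ (MvPolynomial.X k.succ)) with hχ
        have hχψ : ∀ q, χ (ψ q) = mkQ q := by
          intro q
          induction q using MvPolynomial.induction_on with
          | C a => simp [hψC, hχ]
          | add p q hp hq => simp [map_add, hp, hq]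
          | mul_X p k hp =>
            rw [map_mul, map_mul, hp, map_mul]
            congr 1
            refine Fin.cases ?_ (fun k' => ?_) k
            · rw [hψX0, map_zero]
              exact ((Ideal.Quotient.eq_zero_iff_mem).2 hX0).symm
            · rw [hψXs]; simp [hχ]
        have hχsurj : Function.Surjective χ := by
          have : Function.Surjective (χ ∘ ψ) := by
            intro x
            obtain ⟨q, rfl⟩ := Ideal.Quotient.mk_surjective x
            exact ⟨q, hχψ q⟩
          exact this.of_comp
        set N : Ideal (MvPolynomial (Fin d) (R ⧸ P)) := RingHom.ker χ with hN
        have hNmax : N.IsMaximal := RingHom.ker_isMaximal_of_surjective χ hχsurj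
        have hvN : MvPolynomial.C (Ideal.Quotient.mk P v) ∈ N := by
          rw [hN, RingHom.mem_ker, ← hψC, hχψ]
          exact (Ideal.Quotient.eq_zero_iff_mem).2 (hCQ v hvM)
        have hXN : (MvPolynomial.X i : MvPolynomial (Fin d) (R ⧸ P)) ∈ N := by
          rw [hN, RingHom.mem_ker, ← hψXs, hχψ]
          exact (Ideal.Quotient.eq_zero_iff_mem).2 hXj
        have hnot := hC i N hNmax hvN hXN
        apply hnot
        -- transport the membership
        have hψQ : Ideal.map (ψ : MvPolynomial (Fin (d + 1)) R →+* MvPolynomial (Fin d) (R ⧸ P)) Q ≤ N := by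
          rw [Ideal.map_le_iff_le_comap]
          intro q hq
          rw [Ideal.mem_comap, hN, RingHom.mem_ker]
          show χ (ψ q) = 0
          rw [hχψ]
          exact (Ideal.Quotient.eq_zero_iff_mem).2 hq
        have hψrel : Ideal.map (ψ : MvPolynomial (Fin (d + 1)) R →+* MvPolynomial (Fin d) (R ⧸ P))
            (chartRel c i.succ) = ⊥ := by
          rw [chartRel, Ideal.map_span, Ideal.span_eq_bot]
          rintro _ ⟨_, ⟨k, rfl⟩, rfl⟩
          have h1 : ψ (MvPolynomial.C (c k)) = 0 := by
            rw [hψC, (Ideal.Quotient.eq_zero_iff_mem).2 (hcP k), MvPolynomial.C_0]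
          have h2 : ψ (MvPolynomial.C (c i.succ)) = 0 := by
            rw [hψC, (Ideal.Quotient.eq_zero_iff_mem).2 (hcP i.succ), MvPolynomial.C_0]
          simp [map_sub, map_mul, h1, h2]
        have hmem' : ψ (dehomog i.succ F) ∈ N ^ n := by
          have h := Ideal.mem_map_of_mem (ψ : MvPolynomial (Fin (d + 1)) R →+* MvPolynomial (Fin d) (R ⧸ P)) hmem
          rw [Ideal.map_sup, hψrel, bot_sup_eq, Ideal.map_pow] at h
          exact Ideal.pow_right_mono hψQ n h
        have hGN : ψ (dehomog i.succ G) ∈ N ^ n := by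
          have h := algHom_apply_mem_of_coeff_mem
            (ψ.comp (MvPolynomial.aeval fun i' : Fin (d + 1) =>
              if i' = i.succ then (1 : MvPolynomial (Fin (d + 1)) R) else MvPolynomial.X i'))
            P (N ^ n) ?_ G hGc
          · simpa [dehomog] using h
          · intro b hb
            rw [MvPolynomial.algebraMap_apply, Ideal.Quotient.algebraMap_eq, (Ideal.Quotient.eq_zero_iff_mem).2 hb,
              MvPolynomial.C_0]
            exact Ideal.zero_mem _
        have hX0N : ψ (dehomog i.succ (MvPolynomial.X 0 ^ n)) = 0 := by
          rw [hdX, map_pow, hψX0]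
          exact zero_pow hn
        have key : ∀ H : MvPolynomial (Fin d) R,
            ψ (dehomog i.succ (MvPolynomial.rename Fin.succ H)) =
              dehomog i (MvPolynomial.map (Ideal.Quotient.mk P) H) := by
          intro H
          induction H using MvPolynomial.induction_on with
          | C a => simp [dehomog, hψC]
          | add p q hp hq => simp only [dehomog] at hp hq ⊢; simp only [map_add, hp, hq]
          | mul_X p k hp =>
            simp only [dehomog] at hp ⊢
            simp only [map_mul, MvPolynomial.rename_X, MvPolynomial.aeval_X, MvPolynomial.map_X, hp]
            congr 1
            by_cases hk : k = i
            · subst hk; simp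
            · have : (Fin.succ k) ≠ Fin.succ i := fun h => hk (Fin.succ_inj.1 h)
              simp [hk, this, hψXs]
        have hΦN : ψ (dehomog i.succ Φt) ∈ N ^ n := by
          have h := (N ^ n).sub_mem ((N ^ n).sub_mem hmem' hGN) (Ideal.zero_mem _)
          rw [hsplit, map_add, map_add, hX0N, zero_add, sub_zero, add_sub_cancel_right] at h
          exact h
        rwa [hΦt, key] at hΦN
      · -- `X 0` is a unit mod `Q`
        have : (MvPolynomial.X 0 : MvPolynomial (Fin (d + 1)) R) ^ n ∈ Q := by
          have h := Q.sub_mem (Q.sub_mem hFQ hGQ) hΦtQ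
          rwa [hsplit, hdX, add_sub_cancel_right, add_sub_cancel_right] at h
        exact hX0 (hQ.isPrime.mem_of_pow_mem n this)

/-- Quantifier-shape sanity (critic cn21 (3)): at marking `n = 0` the test FAILS as soon as `M` is proper — the
fibre condition `Q ⊇ M·R[X] + (X_j)` is satisfiable (the phantom variable `X_j` is NOT set to `1` in the ring; only
`dehomog_j` substitutes it in the witness `F`), and `Q ^ 0 = ⊤`. [folklore] -/
theorem not_jetShallow_zero (M : Ideal R) (hM : M ≠ ⊤) (c : Fin (d + 1) → R) (J : Ideal R) :
    ¬ JetShallow M c J 0 := by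
  intro h
  haveI : Nontrivial (R ⧸ M) := Ideal.Quotient.nontrivial_iff.2 hM
  set θ : MvPolynomial (Fin (d + 1)) R →+* R ⧸ M :=
    MvPolynomial.eval₂Hom (Ideal.Quotient.mk M) (fun _ => 0) with hθ
  obtain ⟨Q, hQmax, hQ⟩ := Ideal.exists_le_maximal (RingHom.ker θ) (RingHom.ker_ne_top θ)
  have hMQ : Ideal.map (MvPolynomial.C : R →+* MvPolynomial (Fin (d + 1)) R) M ≤ Q := by
    rw [Ideal.map_le_iff_le_comap]
    intro a ha
    refine hQ ?_
    rw [RingHom.mem_ker, hθ, MvPolynomial.coe_eval₂Hom, MvPolynomial.eval₂_C]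
    exact (Ideal.Quotient.eq_zero_iff_mem).2 ha
  have hX : (MvPolynomial.X 0 : MvPolynomial (Fin (d + 1)) R) ∈ Q := by
    refine hQ ?_
    rw [RingHom.mem_ker, hθ, MvPolynomial.coe_eval₂Hom, MvPolynomial.eval₂_X]
  obtain ⟨F, -, -, hF⟩ := h 0 Q hQmax hMQ hX
  exact hF (by simp)

/-- [rev 1] **CONE-TAIL test (CT)** (readable sub-test (c) of the module docstring, now TYPED) for a NORMALISED
slope-one presentation `f = zⁿ + v·Ψ(u) + Γ(u) + z·h + g`,
`Γ = Σ U_i γ_i` the first tail layer (degree `n+1`), `h ∈ (c)ⁿ`, `g ∈ (c)ⁿ⁺²`: at every closed point `θ` of every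
chart of the exceptional fibre over the closed point, EITHER the cone branch (`v̄Ψ̄_j ∉ 𝔑ⁿ`, = g14 (C) for `Φ = vΨ`)
OR the tail branch (`Γ̄_j(θ) ≠ 0`, i.e. `dehomog_j Γ̄ ∉ 𝔑`).  The test reads only `Γ = Σ U_i γ_i` (any presentation `γ`
of the layer gives the same predicate).  DEFINITION (NEW class predicate, strictly between g14's (C) and (J) on the
typed bed: `conetail:2` passes (CT), fails (C)). (Sources: Hironaka1967; CossartJannsenSaito2020 Ch. 2, Ch. 8.) -/
def ConeTailShallow (P : Ideal R) (v : R) (Ψ : MvPolynomial (Fin d) R) (γ : Fin d → MvPolynomial (Fin d) R)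
    (n : ℕ) : Prop :=
  ∀ (j : Fin d) (N : Ideal (MvPolynomial (Fin d) (R ⧸ P))), N.IsMaximal →
    MvPolynomial.C (Ideal.Quotient.mk P v) ∈ N → (MvPolynomial.X j : MvPolynomial (Fin d) (R ⧸ P)) ∈ N →
      dehomog j (MvPolynomial.map (Ideal.Quotient.mk P) (MvPolynomial.C v * Ψ)) ∉ N ^ n ∨
      dehomog j (MvPolynomial.map (Ideal.Quotient.mk P) (∑ i, MvPolynomial.X i * γ i)) ∉ N

end JetKernels

end Summit.ResolutionOfSingularities.ResolutionOfSingularities.Theorems.JetCut
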